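import Summits.RiemannHypothesis.RiemannHypothesis.Theorems.SignConeCondRungCoefTable
import Summits.RiemannHypothesis.RiemannHypothesis.Theorems.SignConePointwiseSOSTailBound

/-!
# Route SignCone — conditional rungs, VIII: the honest comb against an SOS correction with rational coefficients

Items stmt-RiemannHypothesis-16301/16302. The SOS tail certificates (`SOSData`, `comb_sub_Hsos_le`) bound
`Σ_n q_n cos(y log n) − Hsos(y) ≤ sosBound` for RATIONAL coefficients `q_n`; the honest comb has the irrational coefficients
`2Λ(n)/√n`. A two-sided coefficient table (`CoefTable2`: `sqrtLo n ≤ √n ≤ sqrtHi n`, engine enclosures of `log p`) certifies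
`|2Λ(n)/√n − q_n| ≤ e_n`, whence (`honestComb_sub_Hsos_le`)
`honestComb N y − Hsos(y) ≤ sosBound (nodes 2..N) q + Σ_n e_n` — the comb bound `M` of Theorem A with an SOS correction.
-/

noncomputable section

-- `Summit.RiemannHypothesis.RiemannHypothesis.…` repeats a namespace component by design (D-0017 layout).
set_option linter.dupNamespace false

open scoped BigOperators ArithmeticFunction.vonMangoldt
open Literature.Analysis.ValidatedNumerics.Numerics

namespace Summit.RiemannHypothesis.RiemannHypothesis.Theorems.SignCone

/-- Two-sided table: `sqrtLo n ≤ √n ≤ sqrtHi n` and the rational comb coefficients `q n ≈ 2Λ(n)/√n`. [folklore] -/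
structure CoefTable2 where
  /-- last node -/
  N : ℕ
  /-- `sqrtLo[n] ≤ √n` -/
  sqrtLo : List ℚ
  /-- `√n ≤ sqrtHi[n]` -/
  sqrtHi : List ℚ
  /-- rational comb coefficients -/
  q : List ℚ

namespace CoefTable2

variable (C : CoefTable2)

/-- `sqrtLo n`. [folklore] -/
def sqLo (n : ℕ) : ℚ := C.sqrtLo.getD n 0
/-- `sqrtHi n`. [folklore] -/
def sqHi (n : ℕ) : ℚ := C.sqrtHi.getD n 0
/-- `q n`. [folklore] -/
def qAt (n : ℕ) : ℚ := C.q.getD n 0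

/-- The certified coefficient error `e n = max(2 loghi(p)/sqrtLo n − q n, q n − 2 loglo(p)/sqrtHi n)` on prime powers
(`p = minFac n`), `0` elsewhere. [folklore] -/
def errAt (logs : List FI) (n : ℕ) : ℚ :=
  if IsPrimePow n then
    max (2 * (logs.getD n.minFac (FI.ofInt 0)).hiQ / C.sqLo n - C.qAt n)
      (C.qAt n - 2 * (logs.getD n.minFac (FI.ofInt 0)).loQ / C.sqHi n)
  else 0

/-- The check at one node. [folklore] -/
def checkAt (logs : List FI) (n : ℕ) : Bool :=
  if IsPrimePow n then
    decide (0 < C.sqLo n) && decide (C.sqLo n ^ 2 ≤ n) && decide ((n : ℚ) ≤ C.sqHi n ^ 2) &&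
      decide (0 ≤ C.sqHi n) && decide (0 ≤ (logs.getD n.minFac (FI.ofInt 0)).loQ)
  else decide (C.qAt n = 0)

/-- The whole check. [folklore] -/
def check : Bool :=
  FI.logTableOK C.N && (List.range (C.N + 1)).all (C.checkAt (FI.logTable C.N))

/-- `Σ_{n ≤ N} e n`. [folklore] -/
def errTotal : ℚ := ((List.range (C.N + 1)).map (C.errAt (FI.logTable C.N))).sum

/-- **Soundness at a node**: `|2Λ(n)/√n − q n| ≤ e n` (in the one-sided form that is used). [folklore] -/
theorem sound (h : C.check = true) {n : ℕ} (hn : n ≤ C.N) :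
    2 * Λ n / Real.sqrt n - C.qAt n ≤ (C.errAt (FI.logTable C.N) n : ℝ) ∧
      C.qAt n - 2 * Λ n / Real.sqrt n ≤ (C.errAt (FI.logTable C.N) n : ℝ) := by
  unfold check at h
  rw [Bool.and_eq_true, List.all_eq_true] at h
  obtain ⟨hok, hall⟩ := h
  have hc := hall n (List.mem_range.2 (by omega))
  unfold checkAt at hc
  unfold errAt
  rw [ArithmeticFunction.vonMangoldt_apply]
  by_cases hp : IsPrimePow n
  · simp only [hp, if_true] at hc ⊢
    simp only [Bool.and_eq_true, decide_eq_true_eq] at hc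
    obtain ⟨⟨⟨⟨hs0, hs2⟩, hs3⟩, hsh⟩, hl0⟩ := hc
    set I : FI := (FI.logTable C.N).getD n.minFac (FI.ofInt 0) with hI
    have hs0' : (0 : ℝ) < C.sqLo n := by exact_mod_cast hs0
    have hsqlo : (C.sqLo n : ℝ) ≤ Real.sqrt n := by rw [Real.le_sqrt' hs0']; exact_mod_cast hs2
    have hsqhi : Real.sqrt n ≤ (C.sqHi n : ℝ) := by
      rw [Real.sqrt_le_left (by exact_mod_cast hsh)]; exact_mod_cast hs3
    have hmin : n.minFac ≤ C.N := (Nat.minFac_le hp.pos).trans hn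
    have hmem := FI.mem_logTable hok hmin
    have hloghi : Real.log n.minFac ≤ (I.hiQ : ℝ) := FI.le_hiQ hmem
    have hloglo : (I.loQ : ℝ) ≤ Real.log n.minFac := FI.loQ_le hmem
    have hl0' : (0 : ℝ) ≤ I.loQ := by exact_mod_cast hl0
    have hlog0 : 0 ≤ Real.log n.minFac := Real.log_natCast_nonneg _
    have hsq0 : 0 < Real.sqrt n := lt_of_lt_of_le hs0' hsqlo
    have hhi0 : 0 < (C.sqHi n : ℝ) := lt_of_lt_of_le hsq0 hsqhi
    push_cast
    constructor
    · refine le_trans ?_ (le_max_left _ _)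
      have : 2 * Real.log n.minFac / Real.sqrt n ≤ 2 * (I.hiQ : ℝ) / C.sqLo n :=
        calc 2 * Real.log n.minFac / Real.sqrt n ≤ 2 * (I.hiQ : ℝ) / Real.sqrt n :=
              div_le_div_of_nonneg_right (by linarith) hsq0.le
          _ ≤ 2 * (I.hiQ : ℝ) / C.sqLo n :=
              div_le_div_of_nonneg_left (by linarith) hs0' hsqlo
      linarith
    · refine le_trans ?_ (le_max_right _ _)
      have : 2 * (I.loQ : ℝ) / C.sqHi n ≤ 2 * Real.log n.minFac / Real.sqrt n :=
        calc 2 * (I.loQ : ℝ) / C.sqHi n ≤ 2 * (I.loQ : ℝ) / Real.sqrt n :=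
              div_le_div_of_nonneg_left (by linarith) hsq0 hsqhi
          _ ≤ 2 * Real.log n.minFac / Real.sqrt n :=
              div_le_div_of_nonneg_right (by linarith) hsq0.le
      linarith
  · simp only [hp, if_false, decide_eq_true_eq] at hc ⊢
    rw [hc, mul_zero, zero_div]
    push_cast
    simp

/-- `Σ_{n ≤ N} (2Λ(n)/√n − q n) cos(y log n) ≤ Σ e n`: the honest comb is the rational comb up to `errTotal`. [folklore] -/
theorem honestComb_sub_ratComb_le (h : C.check = true) (y : ℝ) :
    honestComb C.N y - ∑ n ∈ Finset.range (C.N + 1), (C.qAt n : ℝ) * Real.cos (y * Real.log n) ≤ (C.errTotal : ℝ) := by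
  unfold honestComb errTotal
  rw [← finset_sum_range_eq_list_sum, ← Finset.sum_sub_distrib]
  push_cast
  refine Finset.sum_le_sum fun n hn => ?_
  rw [Finset.mem_range] at hn
  obtain ⟨h1, h2⟩ := C.sound h (n := n) (by omega)
  have hc := Real.abs_cos_le_one (y * Real.log n)
  rw [abs_le] at hc
  rw [← sub_mul]
  rcases le_or_gt 0 (2 * Λ n / Real.sqrt n - C.qAt n) with hd | hd
  · calc (2 * Λ n / Real.sqrt n - C.qAt n) * Real.cos (y * Real.log n)
        ≤ (2 * Λ n / Real.sqrt n - C.qAt n) * 1 := mul_le_mul_of_nonneg_left hc.2 hd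
      _ ≤ _ := by linarith
  · calc (2 * Λ n / Real.sqrt n - C.qAt n) * Real.cos (y * Real.log n)
        ≤ (2 * Λ n / Real.sqrt n - C.qAt n) * (-1) := mul_le_mul_of_nonpos_left hc.1 hd.le
      _ ≤ _ := by linarith

/-- The rational comb over `Finset.range (N+1)` as the node-list sum over `2..N` used by the SOS checker
(`q 0 = q 1 = 0` since `0, 1` are not prime powers). [folklore] -/
theorem ratComb_eq_list_sum (h : C.check = true) (hN : 2 ≤ C.N) (y : ℝ) :
    ∑ n ∈ Finset.range (C.N + 1), (C.qAt n : ℝ) * Real.cos (y * Real.log n) =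
      ((List.range' 2 (C.N - 1)).map fun n => (C.qAt n : ℝ) * Real.cos (y * Real.log n)).sum := by
  have h0 : C.qAt 0 = 0 ∧ C.qAt 1 = 0 := by
    unfold check at h
    rw [Bool.and_eq_true, List.all_eq_true] at h
    have a0 := h.2 0 (List.mem_range.2 (by omega))
    have a1 := h.2 1 (List.mem_range.2 (by omega))
    unfold checkAt at a0 a1
    rw [if_neg (by decide), decide_eq_true_eq] at a0 a1
    exact ⟨a0, a1⟩
  rw [finset_sum_range_eq_list_sum]
  have e : List.range (C.N + 1) = List.range' 0 2 ++ List.range' 2 (C.N - 1) := by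
    rw [List.range_eq_range', show C.N + 1 = 2 + (C.N - 1) by omega, List.range'_append]
  rw [e, List.map_append, List.sum_append]
  simp [List.range', h0.1, h0.2]

/-- **The honest comb against an SOS correction**: with the node list `2..N` and rational coefficients `q`,
`honestComb N y − Hsos(y) ≤ sosBound + errTotal`. [folklore] -/
theorem honestComb_sub_Hsos_le (h : C.check = true) (hN : 2 ≤ C.N) (Z : SOSData) {Lq : ℚ}
    (hZ : Z.checkSOS (List.range' 2 (C.N - 1)) Lq = true) (y : ℝ) :
    honestComb C.N y - Z.Hsos y ≤ (Z.sosBound (List.range' 2 (C.N - 1)) C.qAt : ℝ) + C.errTotal := by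
  have h1 := C.honestComb_sub_ratComb_le h y
  have h2 := Z.comb_sub_Hsos_le (a := C.qAt) hZ (List.nodup_range' ) y
  rw [C.ratComb_eq_list_sum h hN] at h1
  linarith

end CoefTable2

end Summit.RiemannHypothesis.RiemannHypothesis.Theorems.SignCone

end
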